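import Mathlib
import HarnessLib
import HarnessLib.Audit
import Summits.Langlands.Statement
import Summits.Langlands.Langlands.Theses.QuarterConductorLadder
import Literature.NumberTheory.Automorphic.HilbertPartialHasseWeightShifting
import Literature.NumberTheory.Automorphic.StrongApproximationGL2
import HarnessLib.Audit.Status.Attr

/-!
Route: SeedParityLadder

It suffices to show X = HOL ∧ MIX ∧ REST, the three cells of the declared-residual belt crux QO =
QuarterConductorLadder.OffQuarterBoxAvatars (stmt-Langlands-26826: semisimple ℓ-adic avatars for
every L-algebraic cuspidal π on GL_n/K in HULL₃ ∖ HULL₂ outside the even-λ=1/4-over-ℚ box) cut by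
ONE nested dial on the member π: «n = 2 and π ≅ BC_K(π₀) ⊗ χ a.e. for a cuspidal π₀ on GL₂ over a
totally real K₀ ⊆ K, L-algebraic of infinity type hilbertInfinityType k w with some k_β = 1, χ an
L-algebraic GL₁ datum over K» (SeedBox), refined by «… and the idèle −1 at every infinite place of
K₀ acts by −1 on π₀» (HolSeedBox: holomorphic sign vector). HOL: QO on HolSeedBox (PRINT: the seed's
irreducible avatar exists — Rogawski–Tunnell, Jarvis, Newton Thm 1; tree item
SenNullAlignment.OddNonRegularAttached — and restricts/twists to every orbit member); MIX: QO on
SeedBox ∖ HolSeedBox (RESIDUAL: ≥ 1 Maass-type weight-one place in every presentation — mixed/even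
parity, no construction in print); REST: QO off SeedBox (RESIDUAL: rank ≥ 3 and CM-seeded
non-regular types). FRAME′ OffQuarterBoxFrame := QO → Langlands is the host route with QO abstracted
(kernel frame_of_host from the tree's QuarterConductorLadder.closes); node kernel
offQuarterBoxAvatars_iff_pieces : QO ↔ HOL ∧ MIX ∧ REST; closes hH hM hR hFr := hFr
(offQuarterBoxAvatars_of_pieces hH hM hR).
Lean: HolomorphicSeedAvatars ∧ MaassTypeSeedAvatars ∧ SeedlessBeltAvatars ∧ OffQuarterBoxFrame

REFINES route-Langlands-QuarterConductorLadder:OffQuarterBoxAvatars (edge split, depth 1; chain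
route-Langlands-QuarterConductorLadder › route-Langlands-SeedParityLadder) — the deciding theorem of
this CHILD route concludes the parent piece
`Summit.Langlands.Langlands.Theses.QuarterConductorLadder.OffQuarterBoxAvatars` BY NAME (imported
from Summits.Langlands.Langlands.Theses.QuarterConductorLadder); closing this route proves that
piece of the parent, never the summit Statement (D-0170).

Rationale: WHY THIS LINE. QO is what g18's conductor ladder left of the belt WHS after removing the (up)-orbit
of the even λ = 1/4 Maass seeds over ℚ; it was declared residual «keeps the belt status», but it is
NOT uniformly dark: it still contains the (up)-orbits (a.e.-twisted weak base changes to every K) of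
the HOLOMORPHIC non-regular Hilbert seeds — classical weight-one newforms (Deligne–Serre), parallel
weight one over totally real fields (Rogawski–Tunnell), partial weight one (Jarvis 1997 Thm 6.1;
Newton 2015 Thm 1 [corpus:paper:arxiv-1409.6535 p.3]; non-CM examples exist, Moy–Specter
[corpus:paper:arxiv-1407.3872 p.2]) — whose avatars are in print and already typed in the tree
(named fact exists_galoisRep_GL2_totallyReal_partialWeightOne = support item
SenNullAlignment.OddNonRegularAttached, stmt-Langlands-16362). What separates this lit region from
the dark one is a datum that NO hull dial can read: the infinity type (all that HasInfinityType
records) is shared by the holomorphic limit of discrete series Ind(μ, μ·sgn) and the even principal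
series Ind(μ, μ) at a weight-one place; the ARCHIMEDEAN SIGN VECTOR ε_u = action of the idèle −1_u
on W/W′ distinguishes them, is twist-invariant (central character × χ², trivial at −1_u) and
base-change-stable at real places, and its Galois dictionary is the parity of ρ(c_u) (odd ↔
holomorphic, even-scalar ↔ Maass-type, Sen-null). Cutting QO by «some seed presentation has ε ≡ −1»
is therefore an orbit-closed cut (not the plain-K₀ costume: OFF members cannot be moved ON by twist
or base change, the quadratic base-change fibre {π₀, π₀ ⊗ ω} having constant sign vector), it is
EXACT by two excluded middles, and it is graded: g(π) = least number m of Maass-type places over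
presentations (node SignBoxLE m / SignRung m, HOL ↔ SignRung 0 := node
holomorphicSeedAvatars_iff_signRung_zero) — with the honest census that print stops EXACTLY at m = 0
in every degree [K₀:ℚ] and every partial weight. Imported area: coherent cohomology of Hilbert
modular varieties in non-regular weight (congruences to regular weight, pseudo-representations) —
the one realization technique that reaches a non-regular type, and only for the holomorphic sign
(Literature.Barriers.Langlands.NonRegularWeightBarrier names exactly this edge).
RANKED CRUXES. 2 · HolomorphicSeedAvatars (HOL: PRINT, attackable now — skeleton birth_HOL: stub₁ =
the tree item SenNullAlignment.OddNonRegularAttached BY NAME (shared staffing with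
route-Langlands-SenNullAlignment), stub₂ = stub_seedTransport (restriction to Γ_K ⊗ the ℓ-adic
character of χ along the a.e. relation; semisimplicity survives), composition kernel-checked). 3 ·
MaassTypeSeedAvatars (MIX: RESIDUAL, IDEA-NEEDED — direction (A) for totally-real GL₂ cusp forms of
non-regular algebraic type with an even principal series at ≥ 1 real place and no holomorphic
presentation: mixed/even-parity partial or parallel weight one; over ℚ-seeds this is g18's quarter
box, already removed; no coherent-cohomology realization, no certified trace-formula census beyond
ℚ). 4 · SeedlessBeltAvatars (REST: RESIDUAL, IDEA-NEEDED — QO members with no totally-real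
non-regular GL₂ seed: weakly-regular non-regular π on GL_n, n ≥ 3 (e.g. a repeated Hodge–Tate weight
on GL₃/ℚ), and GL₂ types seeded only over CM fields (weight one at a complex place); next print rung
in sight: Goldring–Koskivirta holomorphic limits of discrete series on unitary Shimura varieties,
not typable while HasInfinityType forgets the chamber). Support 9 · OffQuarterBoxFrame (host
verbatim). Assembly 1.
KILL CRITERIA. A print derivation of an avatar for a Maass-type-seeded member from HOL plus
descent/patching (i.e. a transport across the sign dial other than twist/BC) would make the cut a
costume — the critic's orbit test (answered in the memo §4: sign vectors are constant on quadratic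
base-change fibres); a cuspidal L-algebraic π in HOL's box without a semisimple avatar refutes
OddNonRegularAttached as typed (a normalisation slip in the Satake clause) and sends HOL back to
typing; a proof that QO's hypotheses already force SeedBox (every n = 2 member of HULL₃ ∖ HULL₂ off
the ℚ-box is TR-Hilbert-seeded) would make REST vacuous in rank 2 — informative, not fatal.
NOT DECOMPOSED YET. MIX is one item (its rungs m = 1, 2, … and the parallel/partial distinction are
memo rows, not items — no print rung among them); REST is one item (rank ≥ 3 vs CM-seeded GL₂ is the
host's business or a later lens); the two skeleton stubs of HOL are single stubs; no third layer.
CHEAPEST FALSIFIER. In Lean: the BC7 probes of HOL/MIX/REST (expected CLEAN; FRAME′ informational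
summit-implies) and the probes file (no piece or pair of pieces gives QO or Langlands on the cheap;
OddNonRegularAttached alone does not give HOL); on paper: check that the sign clause really is
twist-invariant and that OddNonRegularAttached's inlined infinity type is definitionally
hilbertInfinityType k w (its docstring says Iff.rfl) — the skeleton's composition elaborating with
`exact` is that check.

VEHICLE (writer-1, crit-1 row 239 i1). Filed as a REFINING CHILD (`--refines
route-Langlands-QuarterConductorLadder:OffQuarterBoxAvatars`, D-0170 (2)): `closes (hH hM hR) :
QuarterConductorLadder.OffQuarterBoxAvatars` = node `offQuarterBoxAvatars_of_pieces'`; the FRAME′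
item `OffQuarterBoxFrame` of the kit (V-F, `closes : Langlands`) is therefore NOT filed — wherever
the texts above say FRAME′, read «the host route-Langlands-QuarterConductorLadder below QO» (node
`frame_of_host`).

Novelty: Searches RUN (2026-08-30, corpus fts + vec + galaxy): lit search --hybrid «"partial weight one"
Hilbert Galois representation» → noise (Hartshorne, Edixhoven…: the phrase is rare in held books);
lit search (local) «Hilbert modular partial weight» → [corpus:paper:arxiv-1409.6535 p.2–3] Newton
2015 (Thm 1: Galois representations for π discrete series or HOLOMORPHIC limit of discrete series at
every infinite place; §1.1 «to handle the remaining cases seems to require a new idea» — about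
special places, the Maass-type archimedean case is not even posed), [corpus:paper:arxiv-1407.3872
p.2] Moy–Specter (non-CM partial weight one forms over ℚ(√5) exist — HOL has non-dihedral content
beyond parallel weight), [corpus:paper:arxiv-1307.8003 p.5,27] Emerton–Reduzzi–Xiao (Galois
representations and torsion in coherent cohomology of Hilbert modular varieties — the realization
engine, holomorphic only), [corpus:paper:arxiv-2111.04834 p.29–30] (classical weight one forms in
ordinary families; «no results have appeared for forms of partial weight one»),
[corpus:paper:arxiv-1710.02287 p.1] (explicit methods for Hilbert forms of weight 1),
[corpus:paper:arxiv-math_0609460 p.9] Ramakrishnan («the even ones» ↔ Maass, «the odd ones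
correspond to holomorphic newforms of weight 1» — the parity dictionary over ℚ); lit vsearch «Galois
representations for Hilbert modular forms holomorphic limits of discrete series … even principal
series … parity mixed» → nothing relevant (4 unrelated papers); lit gala  [refs: paper:arxiv-1409.6535, paper:arxiv-1407.3872, paper:arxiv-1307.8003, paper:arxiv-2111.04834, paper:arxiv-1710.02287, paper:arxiv-math_0609460]

Barriers (technique_class: coherent cohomology weight one; restriction+CFT; sign ladder): - technique_class: coherent cohomology of Hilbert modular varieties in non-regular (partial weight
one) weight — congruences to regular weight + pseudo-representations (Wiles/Taylor/Jarvis),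
Rogawski–Tunnell for parallel weight one; then restriction to Γ_K and class-field-theoretic
transport of an L-algebraic GL₁ datum along a.e.-twisted base change; no automorphy lifting, no
trace formula, no p-adic interpolation.
- Literature.Barriers.Langlands.NonRegularWeightBarrier: HOL sits INSIDE the barrier's excluded
regime (non-regular: some k_β = 1) but on the ONE edge the barrier's docstring itself exempts —
holomorphic limits of discrete series are realised in COHERENT cohomology of the Hilbert modular
variety (weight-one sheaves), so congruence constructions apply [corpus:paper:arxiv-1409.6535 p.3
Thm 1; corpus:paper:arxiv-1307.8003 p.5]; MIX and REST are where the barrier bites with no evading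
engine (a Maass-type component contributes to no coherent or Betti cohomology of a Shimura variety;
GL_n non-regular types for n ≥ 3 likewise outside the Goldring–Koskivirta LDS list) — DECLARED
RESIDUAL; the bet is only that HOL is bankable now and that «sign vector» is the right NAME for the
boundary of print inside QO.
- Literature.Barriers.Langlands.NonRegularWeightBarrierNarrow: same placement as
NonRegularWeightBarrier above (one record, two decls) — HOL sits INSIDE the barrier's excluded
regime (non-regular: some k_β = 1) but on the ONE edge the barrier's docstring itself exempts —

sub-problem: Langlands · status: draft · opened planner-decomp-langlands-writer-1-g5-0 2026-08-30T23:22:41Z · rev 0 · ledger route-Langlands-SeedParityLadder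
GENERATED by the gate from the ledger (D-0016/17). Provers cite these decls: `theorem foo : Summit.Langlands.Langlands.Theses.SeedParityLadder.<Decl> := …` in Summits/Langlands/Langlands/Theorems/<Name>.lean.
-/

namespace Summit.Langlands.Langlands.Theses.SeedParityLadder

open scoped BigOperators Topology Manifold Classical MeasureTheory ProbabilityTheory Matrix InnerProductSpace ComplexConjugate ContinuousMap
open Filter Set Function TopologicalSpace MeasureTheory

attribute [summit_statement] _root_.Langlands
attribute [summit_statement] _root_.Summit.Langlands.Langlands.Theses.QuarterConductorLadder.OffQuarterBoxAvatars

/-- item stmt-Langlands-27035 · crux · rank 2 · open · by planner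
why it might fail: Typing: OddNonRegularAttached's Satake clause (arith. Frobenius, L-normalised) and the transport must match HULL₃'s (up) relation α^f·c exactly — a half-twist/inverse slip vs Jarvis's convention falsifies the cell as typed; ℓ-adic avatars of L-algebraic GL₁ data over general K: print, not tree.
sources: Jarvis1997 (J. reine angew. Math. 491, Thm 6.1), Newton2015LowWeight = arXiv:1409.6535 = doi:10.2140/ant.2015.9.957, Thm 1, Rem 2, §1.1 [corpus:paper:arxiv-1409.6535 p.2–3], RogawskiTunnell1983 (Invent. Math. 74), DeligneSerre1974 (Ann. Sci. ÉNS 7, Thm 4.1), MoySpecter2015 = arXiv:1407.3872 [corpus:paper:arxiv-1407.3872 p.1–2], Summit.Langlands.Langlands.Theses.SenNullAlignment.OddNonRegularAttached (stmt-Langlands-16362; = Literature.NumberTheory.Automorphic.exists_galoisRep_GL2_totallyReal_partialWeightOne instantiated)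
[crux · HOL · WEAKER than QO (kernel holomorphicSeedAvatars_of_host) · PRINT / ATTACKABLE-NOW] QO =
QuarterConductorLadder.OffQuarterBoxAvatars restricted to the box «n = 2 and π ≅ BC_K(π₀) ⊗ χ a.e.
for a cuspidal π₀ on GL₂ over a totally real K₀ ⊆ K, L-algebraic, of infinity type
hilbertInfinityType k w with some k_β = 1, the idèle −1 at EVERY infinite place of K₀ acting by −1
on π₀ (holomorphic limits of discrete series at the weight-one places); χ an L-algebraic GL₁ datum
over K» (text = QO verbatim + one inserted hypothesis). ENGINE: the seed's irreducible avatar r :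
Γ_{K₀} → GL₂(ℚ̄_ℓ) attached at almost all places exists in print (Rogawski–Tunnell; Jarvis 1997 Thm
6.1; Newton 2015 Thm 1; K₀ = ℚ: Deligne–Serre) = tree item SenNullAlignment.OddNonRegularAttached
(stub₁, BY NAME); ρ := r|_{Γ_K} ⊗ χ_ℓ is semisimple and Satake-compatible with π at almost every w
(Frob_w = Frob_u^{f_w}; stub₂ stub_seedTransport). Skeleton birth_HOL. -/
@[route_item "route-Langlands-SeedParityLadder", crux (experiment := "instrument: kit jobs cited as sources kit: HOME/nodes/lens-1-g19-SeedParityLadder.birth_HOL.lean") (source := "ledger wanted_by.sources on stmt-Langlands-27035, 2026-09-01")]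
def HolomorphicSeedAvatars : Prop :=
  ∀ (K : Type) [Field K] [NumberField K] (n : ℕ) (hcpt : Literature.NumberTheory.Automorphic.isCompact_glFiniteIntegralLevel n K), 0 < n → ∀ (π : Literature.NumberTheory.Automorphic.CuspidalAutomorphicRepData n K hcpt), π.1.IsLAlgebraic → ¬ (n = 2 ∧ ∃ (h₀ : Literature.NumberTheory.Automorphic.isCompact_glFiniteIntegralLevel 2 ℚ) (π₀ : Literature.NumberTheory.Automorphic.CuspidalAutomorphicRepData 2 ℚ h₀) (h₁ : Literature.NumberTheory.Automorphic.isCompact_glFiniteIntegralLevel 1 K) (χ : Literature.NumberTheory.Automorphic.AutomorphicRepData (Literature.NumberTheory.Automorphic.AutomorphyDatum.gl 1 K h₁)), π₀.1.HasArchParameter (fun _ => ({0, 0} : Multiset ℂ)) ∧ (∀ φ ∈ π₀.1.W, Literature.NumberTheory.Automorphic.rightTranslation (Literature.NumberTheory.Automorphic.AdelicGroupData.gl 2 ℚ) ((Literature.NumberTheory.Automorphic.AutomorphyDatum.gl 2 ℚ h₀).ofArch ⟨-1, trivial⟩) φ - φ ∈ π₀.1.W') ∧ χ.IsLAlgebraic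 ∧ ∀ᶠ w : IsDedekindDomain.HeightOneSpectrum (NumberField.RingOfIntegers K) in Filter.cofinite, ∀ (u : IsDedekindDomain.HeightOneSpectrum (NumberField.RingOfIntegers ℚ)) (α : Multiset ℂ) (c : ℂ), w.asIdeal.under (NumberField.RingOfIntegers ℚ) = u.asIdeal → π₀.1.HasSatakeParamAt u α → χ.HasSatakeParamAt w {c} → π.1.HasSatakeParamAt w ((α.map (· ^ w.asIdeal.inertiaDeg (NumberField.RingOfIntegers ℚ))).map (c * ·))) → (n = 2 ∧ ∃ (K₀ : Type) (_ : Field K₀) (_ : NumberField K₀) (_ : Algebra K₀ K), NumberField.IsTotallyReal K₀ ∧ ∃ (h₀ : Literature.NumberTheory.Automorphic.isCompact_glFiniteIntegralLevel 2 K₀) (π₀ : Literature.NumberTheory.Automorphic.CuspidalAutomorphicRepData 2 K₀ h₀) (k : (K₀ →+* ℂ) → ℕ) (w : ℤ) (h₁ : Literature.NumberTheory.Automorphic.isCompact_glFiniteIntegralLevel 1 K) (χ : Literature.NumberTheory.Automorphic.AutomorphicRepData (Literature.NumberTheory.Automorphic.AutomorphyDatum.gl 1 K h₁)), π₀.1.IsLAlgebraic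 ∧ π₀.1.HasInfinityType (Literature.NumberTheory.Automorphic.hilbertInfinityType k w) ∧ (∀ (u : NumberField.InfinitePlace K₀), ∀ φ ∈ π₀.1.W, Literature.NumberTheory.Automorphic.rightTranslation (Literature.NumberTheory.Automorphic.AdelicGroupData.gl 2 K₀) (Matrix.GeneralLinearGroup.scalar (Fin 2) (Units.map (MonoidHom.inl (NumberField.InfiniteAdeleRing K₀) (IsDedekindDomain.FiniteAdeleRing (NumberField.RingOfIntegers K₀) K₀) : NumberField.InfiniteAdeleRing K₀ →* NumberField.AdeleRing (NumberField.RingOfIntegers K₀) K₀) (Units.map (MonoidHom.mulSingle (fun u' : NumberField.InfinitePlace K₀ => u'.Completion) u : u.Completion →* NumberField.InfiniteAdeleRing K₀) (-1)))) φ + φ ∈ π₀.1.W') ∧ (∃ β : K₀ →+* ℂ, k β = 1) ∧ χ.IsLAlgebraic ∧ ∀ᶠ w : IsDedekindDomain.HeightOneSpectrum (NumberField.RingOfIntegers K) in Filter.cofinite, ∀ (u : IsDedekindDomain.HeightOneSpectrum (NumberField.RingOfIntegers K₀)) (α : Multiset ℂ) (c : ℂ), w.asIdeal.under (NumberField.RingOfIntegers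 K₀) = u.asIdeal → π₀.1.HasSatakeParamAt u α → χ.HasSatakeParamAt w {c} → π.1.HasSatakeParamAt w ((α.map (· ^ w.asIdeal.inertiaDeg (NumberField.RingOfIntegers K₀))).map (c * ·))) → ¬ (∀ S : (∀ (K : Type) [Field K] [NumberField K] (n : ℕ) (hcpt : Literature.NumberTheory.Automorphic.isCompact_glFiniteIntegralLevel n K), Literature.NumberTheory.Automorphic.AutomorphicRepData (Literature.NumberTheory.Automorphic.AutomorphyDatum.gl n K hcpt) → Prop), ((∀ (K : Type) [Field K] [NumberField K] (n : ℕ) (hcpt : Literature.NumberTheory.Automorphic.isCompact_glFiniteIntegralLevel n K) (π : Literature.NumberTheory.Automorphic.CuspidalAutomorphicRepData n K hcpt), 0 < n → π.1.IsLAlgebraic → (∃ (K₀ : Type) (_ : Field K₀) (_ : NumberField K₀) (_ : Algebra K₀ K), IsGalois K₀ K ∧ IsCyclic (K ≃ₐ[K₀] K) ∧ (NumberField.IsTotallyReal K₀ ∨ NumberField.IsCMField K₀) ∧ ∃ T : Literature.NumberTheory.Automorphic.InfinityType K n, π.1.HasInfinityType T ∧ (Literature.NumberTheory.Automorphic.InfinityType.automorphicInduction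 K₀ (n * Module.finrank K₀ K) T).IsRegular) → S K n hcpt π.1) ∧ (∀ (K₀ : Type) [Field K₀] [NumberField K₀] (M : Type) [Field M] [NumberField M] [Algebra K₀ M] (n : ℕ) (h₀ : Literature.NumberTheory.Automorphic.isCompact_glFiniteIntegralLevel n K₀) (hM : Literature.NumberTheory.Automorphic.isCompact_glFiniteIntegralLevel n M) (h₁ : Literature.NumberTheory.Automorphic.isCompact_glFiniteIntegralLevel 1 M) (π₀ : Literature.NumberTheory.Automorphic.CuspidalAutomorphicRepData n K₀ h₀) (χ : Literature.NumberTheory.Automorphic.AutomorphicRepData (Literature.NumberTheory.Automorphic.AutomorphyDatum.gl 1 M h₁)) (P : Literature.NumberTheory.Automorphic.AutomorphicRepData (Literature.NumberTheory.Automorphic.AutomorphyDatum.gl n M hM)), π₀.1.IsLAlgebraic → χ.IsLAlgebraic → (∀ᶠ w : IsDedekindDomain.HeightOneSpectrum (NumberField.RingOfIntegers M) in cofinite, ∀ (u : IsDedekindDomain.HeightOneSpectrum (NumberField.RingOfIntegers K₀)) (α : Multiset ℂ) (c : ℂ), w.asIdeal.under (NumberField.RingOfIntegers K₀) = u.asIdeal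 → π₀.1.HasSatakeParamAt u α → χ.HasSatakeParamAt w {c} → P.HasSatakeParamAt w ((α.map (· ^ w.asIdeal.inertiaDeg (NumberField.RingOfIntegers K₀))).map (c * ·))) → S K₀ n h₀ π₀.1 → S M n hM P) ∧ (∀ (K : Type) [Field K] [NumberField K] (L : Type) [Field L] [NumberField L] [Algebra K L] (m n : ℕ) (hL : Literature.NumberTheory.Automorphic.isCompact_glFiniteIntegralLevel m L) (hcpt : Literature.NumberTheory.Automorphic.isCompact_glFiniteIntegralLevel n K) (σ : Literature.NumberTheory.Automorphic.CuspidalAutomorphicRepData m L hL) (π : Literature.NumberTheory.Automorphic.AutomorphicRepData (Literature.NumberTheory.Automorphic.AutomorphyDatum.gl n K hcpt)), 0 < m → σ.1.IsLAlgebraic → (∀ᶠ v : IsDedekindDomain.HeightOneSpectrum (NumberField.RingOfIntegers K) in cofinite, ∀ β : IsDedekindDomain.HeightOneSpectrum (NumberField.RingOfIntegers L) → Multiset ℂ, (∀ w : IsDedekindDomain.HeightOneSpectrum (NumberField.RingOfIntegers L), w.asIdeal.under (NumberField.RingOfIntegers K) = v.asIdeal → σ.1.HasSatakeParamAt w (β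 w)) → ∃ α : Multiset ℂ, π.HasSatakeParamAt v α ∧ Literature.NumberTheory.Automorphic.satakePolynomial α = ∏ᶠ w ∈ {w : IsDedekindDomain.HeightOneSpectrum (NumberField.RingOfIntegers L) | w.asIdeal.under (NumberField.RingOfIntegers K) = v.asIdeal}, (Literature.NumberTheory.Automorphic.satakePolynomial (β w)).comp (Polynomial.X ^ w.asIdeal.inertiaDeg (NumberField.RingOfIntegers K))) → S L m hL σ.1 → S K n hcpt π)) → S K n hcpt π.1) → (∀ S : (∀ (K : Type) [Field K] [NumberField K] (n : ℕ) (hcpt : Literature.NumberTheory.Automorphic.isCompact_glFiniteIntegralLevel n K), Literature.NumberTheory.Automorphic.AutomorphicRepData (Literature.NumberTheory.Automorphic.AutomorphyDatum.gl n K hcpt) → Prop), ((∀ (K : Type) [Field K] [NumberField K] (n : ℕ) (hcpt : Literature.NumberTheory.Automorphic.isCompact_glFiniteIntegralLevel n K) (π : Literature.NumberTheory.Automorphic.CuspidalAutomorphicRepData n K hcpt), 0 < n → π.1.IsLAlgebraic → (∃ (K₀ : Type) (_ : Field K₀) (_ : NumberField K₀) (_ : Algebra K₀ K), IsGalois K₀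 K ∧ IsCyclic (K ≃ₐ[K₀] K) ∧ (NumberField.IsTotallyReal K₀ ∨ NumberField.IsCMField K₀) ∧ ∃ T : Literature.NumberTheory.Automorphic.InfinityType K n, π.1.HasInfinityType T ∧ (Literature.NumberTheory.Automorphic.InfinityType.automorphicInduction K₀ (n * Module.finrank K₀ K) T).IsWeaklyRegular) → S K n hcpt π.1) ∧ (∀ (K₀ : Type) [Field K₀] [NumberField K₀] (M : Type) [Field M] [NumberField M] [Algebra K₀ M] (n : ℕ) (h₀ : Literature.NumberTheory.Automorphic.isCompact_glFiniteIntegralLevel n K₀) (hM : Literature.NumberTheory.Automorphic.isCompact_glFiniteIntegralLevel n M) (h₁ : Literature.NumberTheory.Automorphic.isCompact_glFiniteIntegralLevel 1 M) (π₀ : Literature.NumberTheory.Automorphic.CuspidalAutomorphicRepData n K₀ h₀) (χ : Literature.NumberTheory.Automorphic.AutomorphicRepData (Literature.NumberTheory.Automorphic.AutomorphyDatum.gl 1 M h₁)) (P : Literature.NumberTheory.Automorphic.AutomorphicRepData (Literature.NumberTheory.Automorphic.AutomorphyDatum.gl n M hM)), π₀.1.IsLAlgebraic → χ.IsLAlgebraic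 → (∀ᶠ w : IsDedekindDomain.HeightOneSpectrum (NumberField.RingOfIntegers M) in cofinite, ∀ (u : IsDedekindDomain.HeightOneSpectrum (NumberField.RingOfIntegers K₀)) (α : Multiset ℂ) (c : ℂ), w.asIdeal.under (NumberField.RingOfIntegers K₀) = u.asIdeal → π₀.1.HasSatakeParamAt u α → χ.HasSatakeParamAt w {c} → P.HasSatakeParamAt w ((α.map (· ^ w.asIdeal.inertiaDeg (NumberField.RingOfIntegers K₀))).map (c * ·))) → S K₀ n h₀ π₀.1 → S M n hM P) ∧ (∀ (K : Type) [Field K] [NumberField K] (L : Type) [Field L] [NumberField L] [Algebra K L] (m n : ℕ) (hL : Literature.NumberTheory.Automorphic.isCompact_glFiniteIntegralLevel m L) (hcpt : Literature.NumberTheory.Automorphic.isCompact_glFiniteIntegralLevel n K) (σ : Literature.NumberTheory.Automorphic.CuspidalAutomorphicRepData m L hL) (π : Literature.NumberTheory.Automorphic.AutomorphicRepData (Literature.NumberTheory.Automorphic.AutomorphyDatum.gl n K hcpt)), 0 < m → σ.1.IsLAlgebraic → (∀ᶠ v : IsDedekindDomain.HeightOneSpectrum (NumberField.RingOfIntegers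 K) in cofinite, ∀ β : IsDedekindDomain.HeightOneSpectrum (NumberField.RingOfIntegers L) → Multiset ℂ, (∀ w : IsDedekindDomain.HeightOneSpectrum (NumberField.RingOfIntegers L), w.asIdeal.under (NumberField.RingOfIntegers K) = v.asIdeal → σ.1.HasSatakeParamAt w (β w)) → ∃ α : Multiset ℂ, π.HasSatakeParamAt v α ∧ Literature.NumberTheory.Automorphic.satakePolynomial α = ∏ᶠ w ∈ {w : IsDedekindDomain.HeightOneSpectrum (NumberField.RingOfIntegers L) | w.asIdeal.under (NumberField.RingOfIntegers K) = v.asIdeal}, (Literature.NumberTheory.Automorphic.satakePolynomial (β w)).comp (Polynomial.X ^ w.asIdeal.inertiaDeg (NumberField.RingOfIntegers K))) → S L m hL σ.1 → S K n hcpt π)) → S K n hcpt π.1) → ∀ (ℓ : ℕ) [Fact ℓ.Prime] (ι : PadicAlgCl ℓ ≃+* ℂ), ∃ ρ : Literature.NumberTheory.GaloisRepresentations.FramedGaloisRep K (PadicAlgCl ℓ) n, ρ.toGaloisRep.IsSemisimple ∧ ∀ᶠ v : IsDedekindDomain.HeightOneSpectrum (NumberField.RingOfIntegers K) in Filter.cofinite,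 SatakeFrobCompatibleAt ι π.1 ρ v

/-- item stmt-Langlands-27036 · crux · RESIDUAL (gen 0; summit-strength until shown otherwise, D-0170) · rank 3 · open
reduced to route-Langlands-PolyhedralTypeLadder: SolvableArtinTypeAvatars, NonSolvableTypeSeedAvatars · residual NonSolvableTypeSeedAvatars
refined by: route-Langlands-PolyhedralTypeLadder [split, draft] · by planner
why it might fail: Contains reciprocity (A) for algebraic Maass-type Hilbert cusp forms over totally real K₀ ≠ ℚ (parallel weight one even at a place ↔ Artin reps even there; even-parity partial weight ↔ mixed-parity motives): nothing known constructs ρ; non-dihedral examples outside base change are uncharted.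
sources: Newton2015LowWeight = arXiv:1409.6535 = doi:10.2140/ant.2015.9.957, Thm 1, Rem 2, §1.1 [corpus:paper:arxiv-1409.6535 p.2–3] (§1.1: the non-holomorphic archimedean case is outside the theorem), Calegari ICM 2022 §12 / Literature.Barriers.Langlands.NonRegularWeightBarrier docstring, BookerLeeStrombergsson2020 = arXiv:1803.06016 (the only certified (A)-census, over ℚ), [corpus:paper:arxiv-math_0609460 p.9] (Ramakrishnan: even ↔ Maass parity dictionary), Summit.Langlands.Langlands.Theses.QuarterConductorLadder (QT 26825: the ℚ-tail of the same darkness)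
[crux · MIX · WEAKER than QO (kernel maassTypeSeedAvatars_of_host) · RESIDUAL (IDEA-NEEDED)] QO
restricted to members with a totally-real non-regular GL₂ seed presentation (SeedBox) but NO
holomorphic one (¬HolSeedBox): in every presentation the seed π₀ is an even principal series (Maass
type, parameter {a,a}, central sign +1) at ≥ 1 real place — «mixed / even parity partial or parallel
weight one». Direction (A) here has no engine in print in any degree [K₀:ℚ] ≥ 2 (over ℚ-seeds it is
g18's quarter box, removed from QO): no coherent-cohomology realization of a Maass-type component,
no certified trace-formula census beyond ℚ, coefficient-field rigidity needs integrality the hull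
does not supply. Grading inside: m = number of Maass-type places (node SignRung m; no print rung for
m ≥ 1). -/
@[route_item "route-Langlands-SeedParityLadder", crux (bottleneck := idea) (source := "ledger wanted_by.residual on stmt-Langlands-27036, 2026-09-01")]
def MaassTypeSeedAvatars : Prop :=
  ∀ (K : Type) [Field K] [NumberField K] (n : ℕ) (hcpt : Literature.NumberTheory.Automorphic.isCompact_glFiniteIntegralLevel n K), 0 < n → ∀ (π : Literature.NumberTheory.Automorphic.CuspidalAutomorphicRepData n K hcpt), π.1.IsLAlgebraic → ¬ (n = 2 ∧ ∃ (h₀ : Literature.NumberTheory.Automorphic.isCompact_glFiniteIntegralLevel 2 ℚ) (π₀ : Literature.NumberTheory.Automorphic.CuspidalAutomorphicRepData 2 ℚ h₀) (h₁ : Literature.NumberTheory.Automorphic.isCompact_glFiniteIntegralLevel 1 K) (χ : Literature.NumberTheory.Automorphic.AutomorphicRepData (Literature.NumberTheory.Automorphic.AutomorphyDatum.gl 1 K h₁)), π₀.1.HasArchParameter (fun _ => ({0, 0} : Multiset ℂ)) ∧ (∀ φ ∈ π₀.1.W, Literature.NumberTheory.Automorphic.rightTranslation (Literature.NumberTheory.Automorphic.AdelicGroupData.gl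 2 ℚ) ((Literature.NumberTheory.Automorphic.AutomorphyDatum.gl 2 ℚ h₀).ofArch ⟨-1, trivial⟩) φ - φ ∈ π₀.1.W') ∧ χ.IsLAlgebraic ∧ ∀ᶠ w : IsDedekindDomain.HeightOneSpectrum (NumberField.RingOfIntegers K) in Filter.cofinite, ∀ (u : IsDedekindDomain.HeightOneSpectrum (NumberField.RingOfIntegers ℚ)) (α : Multiset ℂ) (c : ℂ), w.asIdeal.under (NumberField.RingOfIntegers ℚ) = u.asIdeal → π₀.1.HasSatakeParamAt u α → χ.HasSatakeParamAt w {c} → π.1.HasSatakeParamAt w ((α.map (· ^ w.asIdeal.inertiaDeg (NumberField.RingOfIntegers ℚ))).map (c * ·))) → ¬ (n = 2 ∧ ∃ (K₀ : Type) (_ : Field K₀) (_ : NumberField K₀) (_ : Algebra K₀ K), NumberField.IsTotallyReal K₀ ∧ ∃ (h₀ : Literature.NumberTheory.Automorphic.isCompact_glFiniteIntegralLevel 2 K₀) (π₀ : Literature.NumberTheory.Automorphic.CuspidalAutomorphicRepData 2 K₀ h₀) (k : (K₀ →+* ℂ) → ℕ) (w : ℤ) (h₁ : Literature.NumberTheory.Automorphic.isCompact_glFiniteIntegralLevel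 1 K) (χ : Literature.NumberTheory.Automorphic.AutomorphicRepData (Literature.NumberTheory.Automorphic.AutomorphyDatum.gl 1 K h₁)), π₀.1.IsLAlgebraic ∧ π₀.1.HasInfinityType (Literature.NumberTheory.Automorphic.hilbertInfinityType k w) ∧ (∀ (u : NumberField.InfinitePlace K₀), ∀ φ ∈ π₀.1.W, Literature.NumberTheory.Automorphic.rightTranslation (Literature.NumberTheory.Automorphic.AdelicGroupData.gl 2 K₀) (Matrix.GeneralLinearGroup.scalar (Fin 2) (Units.map (MonoidHom.inl (NumberField.InfiniteAdeleRing K₀) (IsDedekindDomain.FiniteAdeleRing (NumberField.RingOfIntegers K₀) K₀) : NumberField.InfiniteAdeleRing K₀ →* NumberField.AdeleRing (NumberField.RingOfIntegers K₀) K₀) (Units.map (MonoidHom.mulSingle (fun u' : NumberField.InfinitePlace K₀ => u'.Completion) u : u.Completion →* NumberField.InfiniteAdeleRing K₀) (-1)))) φ + φ ∈ π₀.1.W') ∧ (∃ β : K₀ →+* ℂ, k β = 1) ∧ χ.IsLAlgebraic ∧ ∀ᶠ w : IsDedekindDomain.HeightOneSpectrum (NumberField.RingOfIntegers K) in Filter.cofinite,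 ∀ (u : IsDedekindDomain.HeightOneSpectrum (NumberField.RingOfIntegers K₀)) (α : Multiset ℂ) (c : ℂ), w.asIdeal.under (NumberField.RingOfIntegers K₀) = u.asIdeal → π₀.1.HasSatakeParamAt u α → χ.HasSatakeParamAt w {c} → π.1.HasSatakeParamAt w ((α.map (· ^ w.asIdeal.inertiaDeg (NumberField.RingOfIntegers K₀))).map (c * ·))) → (n = 2 ∧ ∃ (K₀ : Type) (_ : Field K₀) (_ : NumberField K₀) (_ : Algebra K₀ K), NumberField.IsTotallyReal K₀ ∧ ∃ (h₀ : Literature.NumberTheory.Automorphic.isCompact_glFiniteIntegralLevel 2 K₀) (π₀ : Literature.NumberTheory.Automorphic.CuspidalAutomorphicRepData 2 K₀ h₀) (k : (K₀ →+* ℂ) → ℕ) (w : ℤ) (h₁ : Literature.NumberTheory.Automorphic.isCompact_glFiniteIntegralLevel 1 K) (χ : Literature.NumberTheory.Automorphic.AutomorphicRepData (Literature.NumberTheory.Automorphic.AutomorphyDatum.gl 1 K h₁)), π₀.1.IsLAlgebraic ∧ π₀.1.HasInfinityType (Literature.NumberTheory.Automorphic.hilbertInfinityType k w) ∧ (∃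 β : K₀ →+* ℂ, k β = 1) ∧ χ.IsLAlgebraic ∧ ∀ᶠ w : IsDedekindDomain.HeightOneSpectrum (NumberField.RingOfIntegers K) in Filter.cofinite, ∀ (u : IsDedekindDomain.HeightOneSpectrum (NumberField.RingOfIntegers K₀)) (α : Multiset ℂ) (c : ℂ), w.asIdeal.under (NumberField.RingOfIntegers K₀) = u.asIdeal → π₀.1.HasSatakeParamAt u α → χ.HasSatakeParamAt w {c} → π.1.HasSatakeParamAt w ((α.map (· ^ w.asIdeal.inertiaDeg (NumberField.RingOfIntegers K₀))).map (c * ·))) → ¬ (∀ S : (∀ (K : Type) [Field K] [NumberField K] (n : ℕ) (hcpt : Literature.NumberTheory.Automorphic.isCompact_glFiniteIntegralLevel n K), Literature.NumberTheory.Automorphic.AutomorphicRepData (Literature.NumberTheory.Automorphic.AutomorphyDatum.gl n K hcpt) → Prop), ((∀ (K : Type) [Field K] [NumberField K] (n : ℕ) (hcpt : Literature.NumberTheory.Automorphic.isCompact_glFiniteIntegralLevel n K) (π : Literature.NumberTheory.Automorphic.CuspidalAutomorphicRepData n K hcpt), 0 < n → π.1.IsLAlgebraic → (∃ (K₀ :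 Type) (_ : Field K₀) (_ : NumberField K₀) (_ : Algebra K₀ K), IsGalois K₀ K ∧ IsCyclic (K ≃ₐ[K₀] K) ∧ (NumberField.IsTotallyReal K₀ ∨ NumberField.IsCMField K₀) ∧ ∃ T : Literature.NumberTheory.Automorphic.InfinityType K n, π.1.HasInfinityType T ∧ (Literature.NumberTheory.Automorphic.InfinityType.automorphicInduction K₀ (n * Module.finrank K₀ K) T).IsRegular) → S K n hcpt π.1) ∧ (∀ (K₀ : Type) [Field K₀] [NumberField K₀] (M : Type) [Field M] [NumberField M] [Algebra K₀ M] (n : ℕ) (h₀ : Literature.NumberTheory.Automorphic.isCompact_glFiniteIntegralLevel n K₀) (hM : Literature.NumberTheory.Automorphic.isCompact_glFiniteIntegralLevel n M) (h₁ : Literature.NumberTheory.Automorphic.isCompact_glFiniteIntegralLevel 1 M) (π₀ : Literature.NumberTheory.Automorphic.CuspidalAutomorphicRepData n K₀ h₀) (χ : Literature.NumberTheory.Automorphic.AutomorphicRepData (Literature.NumberTheory.Automorphic.AutomorphyDatum.gl 1 M h₁)) (P : Literature.NumberTheory.Automorphic.AutomorphicRepData (Literature.NumberTheory.Automorphic.AutomorphyDatum.gl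 n M hM)), π₀.1.IsLAlgebraic → χ.IsLAlgebraic → (∀ᶠ w : IsDedekindDomain.HeightOneSpectrum (NumberField.RingOfIntegers M) in cofinite, ∀ (u : IsDedekindDomain.HeightOneSpectrum (NumberField.RingOfIntegers K₀)) (α : Multiset ℂ) (c : ℂ), w.asIdeal.under (NumberField.RingOfIntegers K₀) = u.asIdeal → π₀.1.HasSatakeParamAt u α → χ.HasSatakeParamAt w {c} → P.HasSatakeParamAt w ((α.map (· ^ w.asIdeal.inertiaDeg (NumberField.RingOfIntegers K₀))).map (c * ·))) → S K₀ n h₀ π₀.1 → S M n hM P) ∧ (∀ (K : Type) [Field K] [NumberField K] (L : Type) [Field L] [NumberField L] [Algebra K L] (m n : ℕ) (hL : Literature.NumberTheory.Automorphic.isCompact_glFiniteIntegralLevel m L) (hcpt : Literature.NumberTheory.Automorphic.isCompact_glFiniteIntegralLevel n K) (σ : Literature.NumberTheory.Automorphic.CuspidalAutomorphicRepData m L hL) (π : Literature.NumberTheory.Automorphic.AutomorphicRepData (Literature.NumberTheory.Automorphic.AutomorphyDatum.gl n K hcpt)), 0 < m → σ.1.IsLAlgebraic → (∀ᶠ v :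 IsDedekindDomain.HeightOneSpectrum (NumberField.RingOfIntegers K) in cofinite, ∀ β : IsDedekindDomain.HeightOneSpectrum (NumberField.RingOfIntegers L) → Multiset ℂ, (∀ w : IsDedekindDomain.HeightOneSpectrum (NumberField.RingOfIntegers L), w.asIdeal.under (NumberField.RingOfIntegers K) = v.asIdeal → σ.1.HasSatakeParamAt w (β w)) → ∃ α : Multiset ℂ, π.HasSatakeParamAt v α ∧ Literature.NumberTheory.Automorphic.satakePolynomial α = ∏ᶠ w ∈ {w : IsDedekindDomain.HeightOneSpectrum (NumberField.RingOfIntegers L) | w.asIdeal.under (NumberField.RingOfIntegers K) = v.asIdeal}, (Literature.NumberTheory.Automorphic.satakePolynomial (β w)).comp (Polynomial.X ^ w.asIdeal.inertiaDeg (NumberField.RingOfIntegers K))) → S L m hL σ.1 → S K n hcpt π)) → S K n hcpt π.1) → (∀ S : (∀ (K : Type) [Field K] [NumberField K] (n : ℕ) (hcpt : Literature.NumberTheory.Automorphic.isCompact_glFiniteIntegralLevel n K), Literature.NumberTheory.Automorphic.AutomorphicRepData (Literature.NumberTheory.Automorphic.AutomorphyDatum.gl n K hcpt) → Prop), ((∀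 (K : Type) [Field K] [NumberField K] (n : ℕ) (hcpt : Literature.NumberTheory.Automorphic.isCompact_glFiniteIntegralLevel n K) (π : Literature.NumberTheory.Automorphic.CuspidalAutomorphicRepData n K hcpt), 0 < n → π.1.IsLAlgebraic → (∃ (K₀ : Type) (_ : Field K₀) (_ : NumberField K₀) (_ : Algebra K₀ K), IsGalois K₀ K ∧ IsCyclic (K ≃ₐ[K₀] K) ∧ (NumberField.IsTotallyReal K₀ ∨ NumberField.IsCMField K₀) ∧ ∃ T : Literature.NumberTheory.Automorphic.InfinityType K n, π.1.HasInfinityType T ∧ (Literature.NumberTheory.Automorphic.InfinityType.automorphicInduction K₀ (n * Module.finrank K₀ K) T).IsWeaklyRegular) → S K n hcpt π.1) ∧ (∀ (K₀ : Type) [Field K₀] [NumberField K₀] (M : Type) [Field M] [NumberField M] [Algebra K₀ M] (n : ℕ) (h₀ : Literature.NumberTheory.Automorphic.isCompact_glFiniteIntegralLevel n K₀) (hM : Literature.NumberTheory.Automorphic.isCompact_glFiniteIntegralLevel n M) (h₁ : Literature.NumberTheory.Automorphic.isCompact_glFiniteIntegralLevel 1 M) (π₀ : Literature.NumberTheory.Automorphic.CuspidalAutomorphicRepData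 n K₀ h₀) (χ : Literature.NumberTheory.Automorphic.AutomorphicRepData (Literature.NumberTheory.Automorphic.AutomorphyDatum.gl 1 M h₁)) (P : Literature.NumberTheory.Automorphic.AutomorphicRepData (Literature.NumberTheory.Automorphic.AutomorphyDatum.gl n M hM)), π₀.1.IsLAlgebraic → χ.IsLAlgebraic → (∀ᶠ w : IsDedekindDomain.HeightOneSpectrum (NumberField.RingOfIntegers M) in cofinite, ∀ (u : IsDedekindDomain.HeightOneSpectrum (NumberField.RingOfIntegers K₀)) (α : Multiset ℂ) (c : ℂ), w.asIdeal.under (NumberField.RingOfIntegers K₀) = u.asIdeal → π₀.1.HasSatakeParamAt u α → χ.HasSatakeParamAt w {c} → P.HasSatakeParamAt w ((α.map (· ^ w.asIdeal.inertiaDeg (NumberField.RingOfIntegers K₀))).map (c * ·))) → S K₀ n h₀ π₀.1 → S M n hM P) ∧ (∀ (K : Type) [Field K] [NumberField K] (L : Type) [Field L] [NumberField L] [Algebra K L] (m n : ℕ) (hL : Literature.NumberTheory.Automorphic.isCompact_glFiniteIntegralLevel m L) (hcpt : Literature.NumberTheory.Automorphic.isCompact_glFiniteIntegralLevel n K) (σ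 : Literature.NumberTheory.Automorphic.CuspidalAutomorphicRepData m L hL) (π : Literature.NumberTheory.Automorphic.AutomorphicRepData (Literature.NumberTheory.Automorphic.AutomorphyDatum.gl n K hcpt)), 0 < m → σ.1.IsLAlgebraic → (∀ᶠ v : IsDedekindDomain.HeightOneSpectrum (NumberField.RingOfIntegers K) in cofinite, ∀ β : IsDedekindDomain.HeightOneSpectrum (NumberField.RingOfIntegers L) → Multiset ℂ, (∀ w : IsDedekindDomain.HeightOneSpectrum (NumberField.RingOfIntegers L), w.asIdeal.under (NumberField.RingOfIntegers K) = v.asIdeal → σ.1.HasSatakeParamAt w (β w)) → ∃ α : Multiset ℂ, π.HasSatakeParamAt v α ∧ Literature.NumberTheory.Automorphic.satakePolynomial α = ∏ᶠ w ∈ {w : IsDedekindDomain.HeightOneSpectrum (NumberField.RingOfIntegers L) | w.asIdeal.under (NumberField.RingOfIntegers K) = v.asIdeal}, (Literature.NumberTheory.Automorphic.satakePolynomial (β w)).comp (Polynomial.X ^ w.asIdeal.inertiaDeg (NumberField.RingOfIntegers K))) → S L m hL σ.1 → S K n hcpt π)) → S K n hcpt π.1) → ∀ (ℓ : ℕ)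 [Fact ℓ.Prime] (ι : PadicAlgCl ℓ ≃+* ℂ), ∃ ρ : Literature.NumberTheory.GaloisRepresentations.FramedGaloisRep K (PadicAlgCl ℓ) n, ρ.toGaloisRep.IsSemisimple ∧ ∀ᶠ v : IsDedekindDomain.HeightOneSpectrum (NumberField.RingOfIntegers K) in Filter.cofinite, SatakeFrobCompatibleAt ι π.1 ρ v

/-- item stmt-Langlands-27037 · crux · RESIDUAL (gen 0; summit-strength until shown otherwise, D-0170) · rank 4 · open · by planner
why it might fail: Contains direction (A) for every weakly-regular non-regular type in rank ≥ 3 and for non-regular GL₂ types over CM fields, where no Galois representation has been constructed (outside LDS realised coherently on unitary Shimura varieties, whose archimedean condition the tree cannot yet state).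
sources: GoldringKoskivirta2019 (Invent. Math. 217: strata Hasse invariants, Galois representations for LDS), [galaxy:pdf:4740801180] Carayol–Knapp, Limits of discrete series with infinitesimal character zero, FakhruddinPilloni2021 — tree Literature/NumberTheory/Automorphic/WeaklyRegularGaloisRep.lean, Literature.Barriers.Langlands.NonRegularWeightBarrier, Literature.Barriers.Langlands.ShimuraVarietyRealizationBarrier
[crux · REST · WEAKER than QO (kernel seedlessBeltAvatars_of_host) · RESIDUAL (IDEA-NEEDED)] QO
restricted to members with NO totally-real non-regular GL₂ seed presentation (¬SeedBox):
weakly-regular non-regular L-algebraic π on GL_n/K for n ≥ 3 (a repeated Hodge–Tate weight), and n =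
2 members seeded only over CM fields (weight one at a complex place; non-regular Bianchi-type) — the
part of the belt with no GL₂-over-totally-real presentation at all. Regular seeds (all k_β ≥ 2) are
not presentations: their orbits lie in HULL₂ ((r0)+(up)) and are excluded by QO's ¬HULL₂, so such
members are vacuous here. Next print rung in sight: Goldring–Koskivirta (Invent. 2019) holomorphic
limits of discrete series on unitary Shimura varieties — not typable while HasInfinityType records
only the multiset of weights per embedding (the chamber/degeneracy datum is lost). -/
@[route_item "route-Langlands-SeedParityLadder", crux (bottleneck := idea) (source := "ledger wanted_by.residual on stmt-Langlands-27037, 2026-09-01")]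
def SeedlessBeltAvatars : Prop :=
  ∀ (K : Type) [Field K] [NumberField K] (n : ℕ) (hcpt : Literature.NumberTheory.Automorphic.isCompact_glFiniteIntegralLevel n K), 0 < n → ∀ (π : Literature.NumberTheory.Automorphic.CuspidalAutomorphicRepData n K hcpt), π.1.IsLAlgebraic → ¬ (n = 2 ∧ ∃ (h₀ : Literature.NumberTheory.Automorphic.isCompact_glFiniteIntegralLevel 2 ℚ) (π₀ : Literature.NumberTheory.Automorphic.CuspidalAutomorphicRepData 2 ℚ h₀) (h₁ : Literature.NumberTheory.Automorphic.isCompact_glFiniteIntegralLevel 1 K) (χ : Literature.NumberTheory.Automorphic.AutomorphicRepData (Literature.NumberTheory.Automorphic.AutomorphyDatum.gl 1 K h₁)), π₀.1.HasArchParameter (fun _ => ({0, 0} : Multiset ℂ)) ∧ (∀ φ ∈ π₀.1.W, Literature.NumberTheory.Automorphic.rightTranslation (Literature.NumberTheory.Automorphic.AdelicGroupData.gl 2 ℚ) ((Literature.NumberTheory.Automorphic.AutomorphyDatum.gl 2 ℚ h₀).ofArch ⟨-1, trivial⟩) φ - φ ∈ π₀.1.W') ∧ χ.IsLAlgebraic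 ∧ ∀ᶠ w : IsDedekindDomain.HeightOneSpectrum (NumberField.RingOfIntegers K) in Filter.cofinite, ∀ (u : IsDedekindDomain.HeightOneSpectrum (NumberField.RingOfIntegers ℚ)) (α : Multiset ℂ) (c : ℂ), w.asIdeal.under (NumberField.RingOfIntegers ℚ) = u.asIdeal → π₀.1.HasSatakeParamAt u α → χ.HasSatakeParamAt w {c} → π.1.HasSatakeParamAt w ((α.map (· ^ w.asIdeal.inertiaDeg (NumberField.RingOfIntegers ℚ))).map (c * ·))) → ¬ (n = 2 ∧ ∃ (K₀ : Type) (_ : Field K₀) (_ : NumberField K₀) (_ : Algebra K₀ K), NumberField.IsTotallyReal K₀ ∧ ∃ (h₀ : Literature.NumberTheory.Automorphic.isCompact_glFiniteIntegralLevel 2 K₀) (π₀ : Literature.NumberTheory.Automorphic.CuspidalAutomorphicRepData 2 K₀ h₀) (k : (K₀ →+* ℂ) → ℕ) (w : ℤ) (h₁ : Literature.NumberTheory.Automorphic.isCompact_glFiniteIntegralLevel 1 K) (χ : Literature.NumberTheory.Automorphic.AutomorphicRepData (Literature.NumberTheory.Automorphic.AutomorphyDatum.gl 1 K h₁)), π₀.1.IsLAlgebraic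 ∧ π₀.1.HasInfinityType (Literature.NumberTheory.Automorphic.hilbertInfinityType k w) ∧ (∃ β : K₀ →+* ℂ, k β = 1) ∧ χ.IsLAlgebraic ∧ ∀ᶠ w : IsDedekindDomain.HeightOneSpectrum (NumberField.RingOfIntegers K) in Filter.cofinite, ∀ (u : IsDedekindDomain.HeightOneSpectrum (NumberField.RingOfIntegers K₀)) (α : Multiset ℂ) (c : ℂ), w.asIdeal.under (NumberField.RingOfIntegers K₀) = u.asIdeal → π₀.1.HasSatakeParamAt u α → χ.HasSatakeParamAt w {c} → π.1.HasSatakeParamAt w ((α.map (· ^ w.asIdeal.inertiaDeg (NumberField.RingOfIntegers K₀))).map (c * ·))) → ¬ (∀ S : (∀ (K : Type) [Field K] [NumberField K] (n : ℕ) (hcpt : Literature.NumberTheory.Automorphic.isCompact_glFiniteIntegralLevel n K), Literature.NumberTheory.Automorphic.AutomorphicRepData (Literature.NumberTheory.Automorphic.AutomorphyDatum.gl n K hcpt) → Prop), ((∀ (K : Type) [Field K] [NumberField K] (n : ℕ) (hcpt : Literature.NumberTheory.Automorphic.isCompact_glFiniteIntegralLevel n K) (π : Literature.NumberTheory.Automorphic.CuspidalAutomorphicRepData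 n K hcpt), 0 < n → π.1.IsLAlgebraic → (∃ (K₀ : Type) (_ : Field K₀) (_ : NumberField K₀) (_ : Algebra K₀ K), IsGalois K₀ K ∧ IsCyclic (K ≃ₐ[K₀] K) ∧ (NumberField.IsTotallyReal K₀ ∨ NumberField.IsCMField K₀) ∧ ∃ T : Literature.NumberTheory.Automorphic.InfinityType K n, π.1.HasInfinityType T ∧ (Literature.NumberTheory.Automorphic.InfinityType.automorphicInduction K₀ (n * Module.finrank K₀ K) T).IsRegular) → S K n hcpt π.1) ∧ (∀ (K₀ : Type) [Field K₀] [NumberField K₀] (M : Type) [Field M] [NumberField M] [Algebra K₀ M] (n : ℕ) (h₀ : Literature.NumberTheory.Automorphic.isCompact_glFiniteIntegralLevel n K₀) (hM : Literature.NumberTheory.Automorphic.isCompact_glFiniteIntegralLevel n M) (h₁ : Literature.NumberTheory.Automorphic.isCompact_glFiniteIntegralLevel 1 M) (π₀ : Literature.NumberTheory.Automorphic.CuspidalAutomorphicRepData n K₀ h₀) (χ : Literature.NumberTheory.Automorphic.AutomorphicRepData (Literature.NumberTheory.Automorphic.AutomorphyDatum.gl 1 M h₁)) (P : Literature.NumberTheory.Automorphic.AutomorphicRepData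 (Literature.NumberTheory.Automorphic.AutomorphyDatum.gl n M hM)), π₀.1.IsLAlgebraic → χ.IsLAlgebraic → (∀ᶠ w : IsDedekindDomain.HeightOneSpectrum (NumberField.RingOfIntegers M) in cofinite, ∀ (u : IsDedekindDomain.HeightOneSpectrum (NumberField.RingOfIntegers K₀)) (α : Multiset ℂ) (c : ℂ), w.asIdeal.under (NumberField.RingOfIntegers K₀) = u.asIdeal → π₀.1.HasSatakeParamAt u α → χ.HasSatakeParamAt w {c} → P.HasSatakeParamAt w ((α.map (· ^ w.asIdeal.inertiaDeg (NumberField.RingOfIntegers K₀))).map (c * ·))) → S K₀ n h₀ π₀.1 → S M n hM P) ∧ (∀ (K : Type) [Field K] [NumberField K] (L : Type) [Field L] [NumberField L] [Algebra K L] (m n : ℕ) (hL : Literature.NumberTheory.Automorphic.isCompact_glFiniteIntegralLevel m L) (hcpt : Literature.NumberTheory.Automorphic.isCompact_glFiniteIntegralLevel n K) (σ : Literature.NumberTheory.Automorphic.CuspidalAutomorphicRepData m L hL) (π : Literature.NumberTheory.Automorphic.AutomorphicRepData (Literature.NumberTheory.Automorphic.AutomorphyDatum.gl n K hcpt)), 0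 < m → σ.1.IsLAlgebraic → (∀ᶠ v : IsDedekindDomain.HeightOneSpectrum (NumberField.RingOfIntegers K) in cofinite, ∀ β : IsDedekindDomain.HeightOneSpectrum (NumberField.RingOfIntegers L) → Multiset ℂ, (∀ w : IsDedekindDomain.HeightOneSpectrum (NumberField.RingOfIntegers L), w.asIdeal.under (NumberField.RingOfIntegers K) = v.asIdeal → σ.1.HasSatakeParamAt w (β w)) → ∃ α : Multiset ℂ, π.HasSatakeParamAt v α ∧ Literature.NumberTheory.Automorphic.satakePolynomial α = ∏ᶠ w ∈ {w : IsDedekindDomain.HeightOneSpectrum (NumberField.RingOfIntegers L) | w.asIdeal.under (NumberField.RingOfIntegers K) = v.asIdeal}, (Literature.NumberTheory.Automorphic.satakePolynomial (β w)).comp (Polynomial.X ^ w.asIdeal.inertiaDeg (NumberField.RingOfIntegers K))) → S L m hL σ.1 → S K n hcpt π)) → S K n hcpt π.1) → (∀ S : (∀ (K : Type) [Field K] [NumberField K] (n : ℕ) (hcpt : Literature.NumberTheory.Automorphic.isCompact_glFiniteIntegralLevel n K), Literature.NumberTheory.Automorphic.AutomorphicRepData (Literature.NumberTheory.Automorphic.AutomorphyDatum.gl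 n K hcpt) → Prop), ((∀ (K : Type) [Field K] [NumberField K] (n : ℕ) (hcpt : Literature.NumberTheory.Automorphic.isCompact_glFiniteIntegralLevel n K) (π : Literature.NumberTheory.Automorphic.CuspidalAutomorphicRepData n K hcpt), 0 < n → π.1.IsLAlgebraic → (∃ (K₀ : Type) (_ : Field K₀) (_ : NumberField K₀) (_ : Algebra K₀ K), IsGalois K₀ K ∧ IsCyclic (K ≃ₐ[K₀] K) ∧ (NumberField.IsTotallyReal K₀ ∨ NumberField.IsCMField K₀) ∧ ∃ T : Literature.NumberTheory.Automorphic.InfinityType K n, π.1.HasInfinityType T ∧ (Literature.NumberTheory.Automorphic.InfinityType.automorphicInduction K₀ (n * Module.finrank K₀ K) T).IsWeaklyRegular) → S K n hcpt π.1) ∧ (∀ (K₀ : Type) [Field K₀] [NumberField K₀] (M : Type) [Field M] [NumberField M] [Algebra K₀ M] (n : ℕ) (h₀ : Literature.NumberTheory.Automorphic.isCompact_glFiniteIntegralLevel n K₀) (hM : Literature.NumberTheory.Automorphic.isCompact_glFiniteIntegralLevel n M) (h₁ : Literature.NumberTheory.Automorphic.isCompact_glFiniteIntegralLevel 1 M)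 (π₀ : Literature.NumberTheory.Automorphic.CuspidalAutomorphicRepData n K₀ h₀) (χ : Literature.NumberTheory.Automorphic.AutomorphicRepData (Literature.NumberTheory.Automorphic.AutomorphyDatum.gl 1 M h₁)) (P : Literature.NumberTheory.Automorphic.AutomorphicRepData (Literature.NumberTheory.Automorphic.AutomorphyDatum.gl n M hM)), π₀.1.IsLAlgebraic → χ.IsLAlgebraic → (∀ᶠ w : IsDedekindDomain.HeightOneSpectrum (NumberField.RingOfIntegers M) in cofinite, ∀ (u : IsDedekindDomain.HeightOneSpectrum (NumberField.RingOfIntegers K₀)) (α : Multiset ℂ) (c : ℂ), w.asIdeal.under (NumberField.RingOfIntegers K₀) = u.asIdeal → π₀.1.HasSatakeParamAt u α → χ.HasSatakeParamAt w {c} → P.HasSatakeParamAt w ((α.map (· ^ w.asIdeal.inertiaDeg (NumberField.RingOfIntegers K₀))).map (c * ·))) → S K₀ n h₀ π₀.1 → S M n hM P) ∧ (∀ (K : Type) [Field K] [NumberField K] (L : Type) [Field L] [NumberField L] [Algebra K L] (m n : ℕ) (hL : Literature.NumberTheory.Automorphic.isCompact_glFiniteIntegralLevel m L) (hcpt : Literature.NumberTheory.Automorphic.isCompact_glFiniteIntegralLevel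 n K) (σ : Literature.NumberTheory.Automorphic.CuspidalAutomorphicRepData m L hL) (π : Literature.NumberTheory.Automorphic.AutomorphicRepData (Literature.NumberTheory.Automorphic.AutomorphyDatum.gl n K hcpt)), 0 < m → σ.1.IsLAlgebraic → (∀ᶠ v : IsDedekindDomain.HeightOneSpectrum (NumberField.RingOfIntegers K) in cofinite, ∀ β : IsDedekindDomain.HeightOneSpectrum (NumberField.RingOfIntegers L) → Multiset ℂ, (∀ w : IsDedekindDomain.HeightOneSpectrum (NumberField.RingOfIntegers L), w.asIdeal.under (NumberField.RingOfIntegers K) = v.asIdeal → σ.1.HasSatakeParamAt w (β w)) → ∃ α : Multiset ℂ, π.HasSatakeParamAt v α ∧ Literature.NumberTheory.Automorphic.satakePolynomial α = ∏ᶠ w ∈ {w : IsDedekindDomain.HeightOneSpectrum (NumberField.RingOfIntegers L) | w.asIdeal.under (NumberField.RingOfIntegers K) = v.asIdeal}, (Literature.NumberTheory.Automorphic.satakePolynomial (β w)).comp (Polynomial.X ^ w.asIdeal.inertiaDeg (NumberField.RingOfIntegers K))) → S L m hL σ.1 → S K n hcpt π)) → S K n hcpt π.1) → ∀ (ℓ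 : ℕ) [Fact ℓ.Prime] (ι : PadicAlgCl ℓ ≃+* ℂ), ∃ ρ : Literature.NumberTheory.GaloisRepresentations.FramedGaloisRep K (PadicAlgCl ℓ) n, ρ.toGaloisRep.IsSemisimple ∧ ∀ᶠ v : IsDedekindDomain.HeightOneSpectrum (NumberField.RingOfIntegers K) in Filter.cofinite, SatakeFrobCompatibleAt ι π.1 ρ v

/-- item stmt-Langlands-27038 · assembly · rank 1 · closed · proved by Summit.Langlands.Langlands.Theorems.seedParityLadder_assembly_proof (prover) · by planner
sources: kit: HOME/nodes/lens-1-g19-SeedParityLadder.childroute.glue.lean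
[assembly] the curried deciding implication of the REFINING child (D-0170 `--refines
route-Langlands-QuarterConductorLadder:OffQuarterBoxAvatars`; = node
`offQuarterBoxAvatars_of_pieces` :183 / `offQuarterBoxAvatars_of_pieces'` :193): HOL → MIX → REST →
QO `QuarterConductorLadder.OffQuarterBoxAvatars` (stmt-Langlands-26826, the declared residual belt
cell of the host) — two `Classical.em` case splits on the nested dials (holomorphic seed
presentation / some totally-real non-regular seed presentation / none), unified from the pieces'
hypotheses; inlined in glue.lean. ROOT through the host: node `frame_of_host` :248
(QuarterConductorLadder.closes with QF 26823, QB 26824, QT 26825, FRAME 26827) and `closes` :270 /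
`assembly_holds` :274 (the V-F form with FRAME′, kept in the kit as the certified fallback). -/
@[route_item "route-Langlands-SeedParityLadder"]
def Assembly : Prop :=
  HolomorphicSeedAvatars → MaassTypeSeedAvatars → SeedlessBeltAvatars → Summit.Langlands.Langlands.Theses.QuarterConductorLadder.OffQuarterBoxAvatars

-- `Assembly` holds: proved by `Summit.Langlands.Langlands.Theorems.seedParityLadder_assembly_proof` (its module imports this route file, so no `_holds` link can be stated here).

/-! D-0027 §2.1 — DECIDING THEOREM (planner-authored via `route open/edit --closes-file`; by planner-decomp-langlands-writer-1-g5-0 2026-08-30T23:22:41Z):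
its hypotheses are this route's items and its conclusion the registered leaf `Summit.Langlands.Langlands.Theses.QuarterConductorLadder.OffQuarterBoxAvatars` (rung None, D-0061) (glue_lint), and it elaborates with this file. -/

-- lens-1-g19 · child route SeedParityLadder · the DECIDING THEOREM, REFINING form (D-0170 `--refines route-Langlands-QuarterConductorLadder:OffQuarterBoxAvatars`; crit-1 row 239 i1)
-- hypotheses = the route's own cruxes HOL, MIX, REST; conclusion = the PARENT PIECE QO `QuarterConductorLadder.OffQuarterBoxAvatars` (stmt-Langlands-26826) by name.
-- Proof = node kernel `offQuarterBoxAvatars_of_pieces'` :193 verbatim: two `Classical.em` case splits on the nested dials (holomorphic seed presentation / some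
-- totally-real non-regular seed presentation / none), the dial clauses being unified from the pieces' own hypotheses (no auxiliary definition in the route file).
@[closes "route-Langlands-SeedParityLadder"] theorem closes (hH : HolomorphicSeedAvatars) (hM : MaassTypeSeedAvatars) (hR : SeedlessBeltAvatars) :
    Summit.Langlands.Langlands.Theses.QuarterConductorLadder.OffQuarterBoxAvatars := by
  intro K _ _ n hcpt hn π hL hbox h2 h3 ℓ _ ι
  refine (Classical.em _).elim (fun h₁ => hH K n hcpt hn π hL hbox h₁ h2 h3 ℓ ι) (fun h₁ => ?_)
  exact (Classical.em _).elim (fun h₂ => hM K n hcpt hn π hL hbox h₁ h₂ h2 h3 ℓ ι) (fun h₂ => hR K n hcpt hn π hL hbox h₂ h2 h3 ℓ ι)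

end Summit.Langlands.Langlands.Theses.SeedParityLadder
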